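import Literature.Computability.Cryptography.BLPRSSection4GridParams
import Literature.Probability.Distributions.GaussianRejectionSampler
import Mathlib.Analysis.Complex.ExponentialBounds
import HarnessLib

/-!
# The h₃ machine's discrete Gaussian sampler: parameters of GPV's rejection sampler as functions of `n`, and its negligible distance

Topic `Computability/Cryptography` (LWE), grouping namespace `BLPRS2013`; machine side of pqc.S21's hypothesis `h₃`.
The integers `kⱼ ← D_{ℤ,√(π/θ),c}` of the modulus switch (`LWESwitchSamplingForm.lean`, `LWESwitchMachineKernel.lean`)
are drawn by the rejection sampler of `GaussianRejectionSampler.lean` (`GaussRej.rejLaw θ c s N P w R`; distance bound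
`GaussRej.tvDist_rejLaw_le_of_params`) at the rational `θ = gridTheta c n = n/A²` of `BLPRSSection4GridParams.lean`.
This file fixes the sampler's remaining parameters as explicit functions of `n` (all computable from `1ⁿ` with
`Nat.log`, `Nat.sqrt`, `+`, `*`, `/`) and PROVES the hypotheses of that bound together with a negligible estimate
(everything PROVED, definitions with bodies, no named fact):

* `rejW c n = ⌊log₂ A⌋ + 2` (window `2ʷ ∈ (2A, 4A]`), `rejM c n = A/(2(⌊√n⌋+1))` (the count `m` of the acceptance
  estimate), `rejS n = ⌊log₂ n⌋ + 6` (argument halvings, `2ˢ > 32n`), `rejP n = n` (bits of the acceptance coin),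
  `rejN n = s + n + 2` (Taylor terms), `rejR c n = 96(⌊√n⌋+1)·n` (rounds);
* the hypotheses: `rejS_spec` (`θ(2ʷ+½)² ≤ 2ˢ`), `rejM_spec` (`θ(m+½)² ≤ 1`), `rejM_lt_window` (`m + 1 ≤ 2ʷ`),
  `rejEta_le` (`η := 2^{s+1}/N! + 2^{-P} ≤ 2^{-n+1}`, so `η ≤ ½` for `n ≥ 2`);
* **`tvDist_rejLaw_grid_le`** — for `n ≥ 16` and every centre `c'`,
  `Δ(rejLaw θ c' s N P w R, D_{ℤ,√(π/θ),c'}) ≤ (13 + 48A)·2^{-n}` (given `A ≤ 3n`, true eventually), and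
  **`eventually_rejLaw_grid_le_pow`** — `≤ 1/n^k` eventually, for every `k`.

## References

* C. Gentry, C. Peikert, V. Vaikuntanathan, *Trapdoors for hard lattices and new cryptographic constructions*,
  STOC 2008, §4.1 and Lemma 4.2 (SampleZ: `t(n)·ω(log n)` trials suffice). [GentryPeikertVaikuntanathan2008]
* Z. Brakerski, A. Langlois, C. Peikert, O. Regev, D. Stehlé, *Classical hardness of learning with errors*, STOC 2013;
  arXiv:1306.0281, Lemma 2.3 and §5 (efficient sampling of `D_{Λ+c,r}` to within negligible distance). [BrakerskiEtAl2013]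
-/

noncomputable section

open Filter Literature.Algebra.EuclideanLattices Literature.Probability.Distributions
open scoped Real

namespace Literature.Computability.Cryptography

namespace BLPRS2013

/-! ### The parameters -/

/-- **Window exponent** `w = ⌊log₂ A⌋ + 2` (`2ʷ ∈ (2A, 4A]`). [cite: GentryPeikertVaikuntanathan2008, §4.1 (`t = ω(√log n)` window)] -/
def rejW (c n : ℕ) : ℕ := Nat.log 2 (gridA c n) + 2

/-- **Acceptance count** `m = A/(2(⌊√n⌋+1))` (so that `θ(m+½)² ≤ 1`). [cite: GentryPeikertVaikuntanathan2008, Lemma 4.2] -/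
def rejM (c n : ℕ) : ℕ := gridA c n / (2 * (Nat.sqrt n + 1))

/-- **Argument halvings** `s = ⌊log₂ n⌋ + 6` (`2ˢ > 32n ≥ θ(2ʷ+½)²`). [folklore] -/
def rejS (n : ℕ) : ℕ := Nat.log 2 n + 6

/-- **Bits of the acceptance coin** `P = n`. [folklore] -/
def rejP (n : ℕ) : ℕ := n

/-- **Taylor terms** `N = s + n + 2` (`2^{s+1}/N! ≤ 2^{-(n+1)}`). [folklore] -/
def rejN (n : ℕ) : ℕ := rejS n + n + 2

/-- **Rounds** `R = 96(⌊√n⌋+1)·n` (acceptance probability `≥ 1/(96(⌊√n⌋+1))` per round). [cite: GentryPeikertVaikuntanathan2008, Lemma 4.2] -/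
def rejR (n : ℕ) : ℕ := 96 * (Nat.sqrt n + 1) * n

/-! ### Elementary facts about `A`, `2ʷ`, `m` -/

section Facts

variable {c n : ℕ}

/-- `2A < 2ʷ ≤ 4A`. [folklore] -/
theorem window_bounds (c n : ℕ) : 2 * gridA c n < 2 ^ rejW c n ∧ 2 ^ rejW c n ≤ 4 * gridA c n := by
  have hA : 0 < gridA c n := gridA_pos c n
  have h1 : gridA c n < 2 ^ (Nat.log 2 (gridA c n) + 1) := Nat.lt_pow_succ_log_self (by norm_num) _
  have h2 : 2 ^ Nat.log 2 (gridA c n) ≤ gridA c n := Nat.pow_log_le_self 2 hA.ne'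
  unfold rejW
  constructor
  · calc 2 * gridA c n < 2 * 2 ^ (Nat.log 2 (gridA c n) + 1) := by omega
      _ = 2 ^ (Nat.log 2 (gridA c n) + 2) := by ring
  · calc 2 ^ (Nat.log 2 (gridA c n) + 2) = 4 * 2 ^ Nat.log 2 (gridA c n) := by ring
      _ ≤ 4 * gridA c n := by omega

/-- `√n ≤ A` (indeed `n ≤ A²`). [folklore] -/
theorem sqrt_le_gridA (c n : ℕ) : Real.sqrt n ≤ gridA c n := by
  rw [Real.sqrt_le_left (Nat.cast_nonneg _)]
  exact_mod_cast le_gridA_sq c n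

/-- `m ≤ A/(2√n)` as reals (`⌊√n⌋ + 1 ≥ √n`). [folklore] -/
theorem rejM_le (c : ℕ) {n : ℕ} (hn : 0 < n) : (rejM c n : ℝ) ≤ gridA c n / (2 * Real.sqrt n) := by
  have hn' : (0 : ℝ) < n := by exact_mod_cast hn
  have hs : Real.sqrt n ≤ (Nat.sqrt n : ℝ) + 1 := by
    have h := Nat.lt_succ_sqrt' n
    have h' : (n : ℝ) < ((Nat.sqrt n : ℝ) + 1) ^ 2 := by exact_mod_cast h
    rw [Real.sqrt_le_left (by positivity)]
    exact h'.le
  have hdiv : (rejM c n : ℝ) ≤ (gridA c n : ℝ) / (2 * ((Nat.sqrt n : ℝ) + 1)) := by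
    unfold rejM
    rw [le_div_iff₀ (by positivity)]
    have := Nat.div_mul_le_self (gridA c n) (2 * (Nat.sqrt n + 1))
    exact_mod_cast this
  refine hdiv.trans ?_
  exact div_le_div_of_nonneg_left (Nat.cast_nonneg _) (by positivity) (by linarith)

/-- `m + 1 ≥ A/(2(⌊√n⌋+1))`. [folklore] -/
theorem rejM_add_one_ge (c n : ℕ) : (gridA c n : ℝ) / (2 * ((Nat.sqrt n : ℝ) + 1)) ≤ (rejM c n : ℝ) + 1 := by
  unfold rejM
  have hpos : (0 : ℝ) < 2 * ((Nat.sqrt n : ℝ) + 1) := by positivity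
  rw [div_le_iff₀ hpos]
  have h := Nat.lt_div_mul_add (a := gridA c n) (b := 2 * (Nat.sqrt n + 1)) (by positivity)
  have h' : (gridA c n : ℝ) < ((gridA c n / (2 * (Nat.sqrt n + 1)) : ℕ) : ℝ) * (2 * ((Nat.sqrt n : ℝ) + 1)) + (2 * ((Nat.sqrt n : ℝ) + 1)) := by
    exact_mod_cast h
  nlinarith

/-- **`θ(m+½)² ≤ 1`.** [cite: GentryPeikertVaikuntanathan2008, Lemma 4.2] -/
theorem rejM_spec (c : ℕ) {n : ℕ} (hn : 0 < n) : ((gridTheta c n : ℚ) : ℝ) * ((rejM c n : ℝ) + 1 / 2) ^ 2 ≤ 1 := by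
  have hn' : (0 : ℝ) < n := by exact_mod_cast hn
  have hA : (0 : ℝ) < gridA c n := by exact_mod_cast gridA_pos c n
  have hsn : 0 < Real.sqrt n := Real.sqrt_pos.2 hn'
  have hm := rejM_le c hn
  have hAs : Real.sqrt n ≤ gridA c n := sqrt_le_gridA c n
  -- `m + ½ ≤ A/√n`
  have hm' : (rejM c n : ℝ) + 1 / 2 ≤ gridA c n / Real.sqrt n := by
    have h1 : (gridA c n : ℝ) / (2 * Real.sqrt n) + 1 / 2 ≤ gridA c n / Real.sqrt n := by
      rw [div_add' _ _ _ (by positivity), div_le_div_iff₀ (by positivity) hsn]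
      nlinarith
    linarith
  rw [cast_gridTheta]
  have hm0 : 0 ≤ (rejM c n : ℝ) + 1 / 2 := by positivity
  calc (n : ℝ) / (gridA c n : ℝ) ^ 2 * ((rejM c n : ℝ) + 1 / 2) ^ 2 ≤ (n : ℝ) / (gridA c n : ℝ) ^ 2 * (gridA c n / Real.sqrt n) ^ 2 := by
        gcongr
    _ = 1 := by
        rw [div_pow, Real.sq_sqrt hn'.le]
        field_simp

/-- **`m + 1 ≤ 2ʷ`.** [folklore] -/
theorem rejM_lt_window (c n : ℕ) : rejM c n + 1 ≤ 2 ^ rejW c n := by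
  have h1 : rejM c n ≤ gridA c n := Nat.div_le_self _ _
  have h2 := (window_bounds c n).1
  omega

/-- **`θ(2ʷ+½)² ≤ 2ˢ`** (`θ ≤ n/A²`, `2ʷ ≤ 4A`, `2ˢ > 32n`). [folklore] -/
theorem rejS_spec (c : ℕ) {n : ℕ} (hn : 0 < n) : ((gridTheta c n : ℚ) : ℝ) * ((2 : ℝ) ^ rejW c n + 1 / 2) ^ 2 ≤ (2 : ℝ) ^ rejS n := by
  have hn' : (0 : ℝ) < n := by exact_mod_cast hn
  have hA : (0 : ℝ) < gridA c n := by exact_mod_cast gridA_pos c n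
  have hA1 : (1 : ℝ) ≤ gridA c n := by exact_mod_cast gridA_pos c n
  have hw : ((2 : ℝ) ^ rejW c n) ≤ 4 * gridA c n := by exact_mod_cast (window_bounds c n).2
  have hs : (32 : ℝ) * n < (2 : ℝ) ^ rejS n := by
    have h := Nat.lt_pow_succ_log_self (b := 2) (by norm_num) n
    have h' : (n : ℝ) < (2 : ℝ) ^ (Nat.log 2 n + 1) := by exact_mod_cast h
    unfold rejS
    rw [show Nat.log 2 n + 6 = (Nat.log 2 n + 1) + 5 by omega, pow_add]
    norm_num
    linarith
  rw [cast_gridTheta]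
  have hsq : ((2 : ℝ) ^ rejW c n + 1 / 2) ^ 2 ≤ (9 / 2 * gridA c n) ^ 2 := by
    apply pow_le_pow_left₀ (by positivity)
    linarith
  calc (n : ℝ) / (gridA c n : ℝ) ^ 2 * ((2 : ℝ) ^ rejW c n + 1 / 2) ^ 2 ≤ (n : ℝ) / (gridA c n : ℝ) ^ 2 * (9 / 2 * gridA c n) ^ 2 := by
        gcongr
    _ = 81 / 4 * (n : ℝ) := by field_simp; norm_num
    _ ≤ (2 : ℝ) ^ rejS n := by linarith

/-- `N! ≥ 2^N · … `: `2^{s+1} ≤ 2^{-(n+1)} · N!` in the form `2^{s+1} · 2^{n+1} ≤ N!` (`N = s + n + 2`, `k! ≥ 2^{k-1}`… we use `2^k ≤ (k+1)!`).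
[folklore] -/
theorem two_pow_le_factorial_succ (k : ℕ) : 2 ^ k ≤ (k + 1).factorial := by
  induction k with
  | zero => simp
  | succ k ih =>
    rw [pow_succ, Nat.factorial_succ]
    calc 2 ^ k * 2 ≤ (k + 1).factorial * 2 := Nat.mul_le_mul_right 2 ih
      _ ≤ (k + 1).factorial * (k + 1 + 1) := Nat.mul_le_mul_left _ (by omega)
      _ = (k + 1 + 1) * (k + 1).factorial := by ring

/-- **`η = 2^{s+1}/N! + 2^{-P} ≤ 2^{-n} + 2^{-n} = 2^{-n+1}`** (`N = s + n + 2`, `P = n`). [folklore] -/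
theorem rejEta_le (n : ℕ) : (2 : ℝ) ^ (rejS n + 1) / (rejN n).factorial + 1 / 2 ^ rejP n ≤ 2 / (2 : ℝ) ^ n := by
  have hfac : (2 : ℝ) ^ (rejS n + 1) * 2 ^ n ≤ (rejN n).factorial := by
    have h := two_pow_le_factorial_succ (rejS n + n + 1)
    have h' : ((2 ^ (rejS n + n + 1) : ℕ) : ℝ) ≤ ((rejS n + n + 1 + 1).factorial : ℝ) := by exact_mod_cast h
    unfold rejN
    rw [show rejS n + n + 2 = rejS n + n + 1 + 1 by omega]
    calc (2 : ℝ) ^ (rejS n + 1) * 2 ^ n = 2 ^ (rejS n + n + 1) := by rw [← pow_add]; ring_nf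
      _ ≤ _ := by exact_mod_cast h
  have hp : (0 : ℝ) < 2 ^ n := by positivity
  have hf : (0 : ℝ) < (rejN n).factorial := by exact_mod_cast Nat.factorial_pos _
  have h1 : (2 : ℝ) ^ (rejS n + 1) / (rejN n).factorial ≤ 1 / 2 ^ n := by
    rw [div_le_div_iff₀ hf hp, one_mul]
    exact hfac
  unfold rejP
  calc (2 : ℝ) ^ (rejS n + 1) / (rejN n).factorial + 1 / 2 ^ n ≤ 1 / 2 ^ n + 1 / 2 ^ n := add_le_add h1 le_rfl
    _ = 2 / 2 ^ n := by ring

/-- `η ≤ ½` for `n ≥ 2`. [folklore] -/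
theorem rejEta_le_half {n : ℕ} (hn : 2 ≤ n) : (2 : ℝ) ^ (rejS n + 1) / (rejN n).factorial + 1 / 2 ^ rejP n ≤ 1 / 2 := by
  refine (rejEta_le n).trans ?_
  have h4 : (4 : ℝ) ≤ 2 ^ n := by
    calc (4 : ℝ) = 2 ^ 2 := by norm_num
      _ ≤ 2 ^ n := pow_le_pow_right₀ (by norm_num) hn
  rw [div_le_div_iff₀ (by positivity) (by norm_num)]
  linarith

end Facts

/-! ### The distance bound -/

section Bound

variable {c n : ℕ}

/-- `(1 - p)^R ≤ e^{-pR}` for `0 ≤ p ≤ 1`. [folklore] -/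
theorem one_sub_pow_le_exp_neg_mul {p : ℝ} (hp1 : p ≤ 1) (R : ℕ) : (1 - p) ^ R ≤ Real.exp (-(p * R)) := by
  calc (1 - p) ^ R ≤ (Real.exp (-p)) ^ R := pow_le_pow_left₀ (by linarith) (Real.one_sub_le_exp_neg p) R
    _ = Real.exp (-(p * R)) := by rw [← Real.exp_nat_mul]; ring_nf

/-- `e^{-n} ≤ 2^{-n}`. [folklore] -/
theorem exp_neg_le_inv_two_pow (n : ℕ) : Real.exp (-(n : ℝ)) ≤ 1 / (2 : ℝ) ^ n := by
  rw [Real.exp_neg, one_div]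
  refine inv_anti₀ (by positivity) ?_
  have h2e : (2 : ℝ) ≤ Real.exp 1 := by linarith [Real.add_one_le_exp (1 : ℝ)]
  calc (2 : ℝ) ^ n ≤ Real.exp 1 ^ n := pow_le_pow_left₀ (by norm_num) h2e n
    _ = Real.exp n := by rw [← Real.exp_nat_mul, mul_one]

/-- `192(n+1) ≤ 2ⁿ` for `n ≥ 16`. [folklore] -/
theorem lin_le_two_pow {n : ℕ} (hn : 16 ≤ n) : 192 * ((n : ℝ) + 1) ≤ (2 : ℝ) ^ n := by
  induction n with
  | zero => omega
  | succ k ih =>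
    rcases Nat.lt_or_ge k 16 with hlt | hge
    · have hk16 : k + 1 = 16 := by omega
      rw [hk16]; norm_num
    · have := ih hge
      rw [pow_succ]; push_cast; linarith

/-- **The acceptance probability per round is `≥ 1/(96(⌊√n⌋+1))`** (and `≤ 1`), `n ≥ 16`:
`(m+1)e^{-1}/2^{w+1} ≥ (A/(2(⌊√n⌋+1)))/(3·8A) = 1/(48(⌊√n⌋+1))` and `η ≤ 2^{-n+1} ≤ 1/(96(⌊√n⌋+1))`.
[cite: GentryPeikertVaikuntanathan2008, Lemma 4.2 (acceptance probability of SampleZ)] -/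
theorem rej_accept_bounds (c : ℕ) {n : ℕ} (hn : 16 ≤ n) :
    1 / (96 * ((Nat.sqrt n : ℝ) + 1)) ≤ ((rejM c n : ℝ) + 1) * Real.exp (-1) / 2 ^ (rejW c n + 1) -
        ((2 : ℝ) ^ (rejS n + 1) / (rejN n).factorial + 1 / 2 ^ rejP n) ∧
      ((rejM c n : ℝ) + 1) * Real.exp (-1) / 2 ^ (rejW c n + 1) -
        ((2 : ℝ) ^ (rejS n + 1) / (rejN n).factorial + 1 / 2 ^ rejP n) ≤ 1 := by
  have hA : (0 : ℝ) < gridA c n := by exact_mod_cast gridA_pos c n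
  obtain ⟨hw1, hw2⟩ := window_bounds c n
  have hw2' : ((2 : ℝ) ^ rejW c n) ≤ 4 * gridA c n := by exact_mod_cast hw2
  set η : ℝ := (2 : ℝ) ^ (rejS n + 1) / (rejN n).factorial + 1 / 2 ^ rejP n with hηdef
  have hη0 : 0 ≤ η := by rw [hηdef]; positivity
  have hηle : η ≤ 2 / (2 : ℝ) ^ n := rejEta_le n
  have h2n : (0 : ℝ) < (2 : ℝ) ^ n := by positivity
  have he1 : Real.exp 1 ≤ 3 := le_of_lt (lt_trans Real.exp_one_lt_d9 (by norm_num))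
  have hem1 : 1 / 3 ≤ Real.exp (-1) := by
    rw [Real.exp_neg, one_div]
    exact inv_anti₀ (Real.exp_pos 1) he1
  set mR : ℝ := (rejM c n : ℝ) with hmRdef
  have hm1 : (gridA c n : ℝ) / (2 * ((Nat.sqrt n : ℝ) + 1)) ≤ mR + 1 := rejM_add_one_ge c n
  have hsq1 : (0 : ℝ) < (Nat.sqrt n : ℝ) + 1 := by positivity
  constructor
  · have h1 : 1 / (16 * ((Nat.sqrt n : ℝ) + 1)) ≤ (mR + 1) / 2 ^ (rejW c n + 1) := by
      rw [pow_succ, div_le_div_iff₀ (by positivity) (by positivity)]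
      calc 1 * ((2 : ℝ) ^ rejW c n * 2) ≤ 8 * gridA c n := by linarith
        _ = (gridA c n / (2 * ((Nat.sqrt n : ℝ) + 1))) * (16 * ((Nat.sqrt n : ℝ) + 1)) := by field_simp; ring
        _ ≤ (mR + 1) * (16 * ((Nat.sqrt n : ℝ) + 1)) := mul_le_mul_of_nonneg_right hm1 (by positivity)
    have h2 : 1 / (48 * ((Nat.sqrt n : ℝ) + 1)) ≤ (mR + 1) * Real.exp (-1) / 2 ^ (rejW c n + 1) := by
      rw [mul_div_right_comm]
      calc 1 / (48 * ((Nat.sqrt n : ℝ) + 1)) = 1 / (16 * ((Nat.sqrt n : ℝ) + 1)) * (1 / 3) := by field_simp; ring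
        _ ≤ (mR + 1) / 2 ^ (rejW c n + 1) * Real.exp (-1) := mul_le_mul h1 hem1 (by norm_num) (by positivity)
    have h3 : η ≤ 1 / (96 * ((Nat.sqrt n : ℝ) + 1)) := by
      refine hηle.trans ?_
      rw [div_le_div_iff₀ h2n (by positivity)]
      have hs : (Nat.sqrt n : ℝ) ≤ n := by exact_mod_cast Nat.sqrt_le_self n
      have hlin := lin_le_two_pow hn
      nlinarith
    have e : 1 / (48 * ((Nat.sqrt n : ℝ) + 1)) = 2 * (1 / (96 * ((Nat.sqrt n : ℝ) + 1))) := by field_simp; norm_num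
    linarith
  · have h1 : (mR + 1) / 2 ^ (rejW c n + 1) ≤ 1 := by
      rw [div_le_one (by positivity)]
      have : (rejM c n : ℝ) + 1 ≤ (2 : ℝ) ^ rejW c n := by exact_mod_cast rejM_lt_window c n
      have h2w : (2 : ℝ) ^ rejW c n ≤ 2 ^ (rejW c n + 1) := pow_le_pow_right₀ (by norm_num) (by omega)
      linarith
    have h2 : Real.exp (-1) ≤ 1 := by
      rw [Real.exp_neg]
      exact inv_le_one_of_one_le₀ (by linarith [Real.add_one_le_exp (1 : ℝ)])
    have : (mR + 1) * Real.exp (-1) / 2 ^ (rejW c n + 1) ≤ 1 := by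
      rw [mul_div_right_comm]
      calc (mR + 1) / 2 ^ (rejW c n + 1) * Real.exp (-1) ≤ 1 * 1 := mul_le_mul h1 h2 (Real.exp_pos _).le (by norm_num)
        _ = 1 := by ring
    linarith

/-- **Term 1**: `R = 96(⌊√n⌋+1)n` rounds all fail with probability `≤ e^{-n} ≤ 2^{-n}`. [cite: GentryPeikertVaikuntanathan2008, Lemma 4.2] -/
theorem rej_term1 (c : ℕ) {n : ℕ} (hn : 16 ≤ n) :
    (1 - (((rejM c n : ℝ) + 1) * Real.exp (-1) / 2 ^ (rejW c n + 1) -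
        ((2 : ℝ) ^ (rejS n + 1) / (rejN n).factorial + 1 / 2 ^ rejP n))) ^ rejR n ≤ 1 / (2 : ℝ) ^ n := by
  obtain ⟨hp₀, hp₁⟩ := rej_accept_bounds c hn
  set p : ℝ := ((rejM c n : ℝ) + 1) * Real.exp (-1) / 2 ^ (rejW c n + 1) -
    ((2 : ℝ) ^ (rejS n + 1) / (rejN n).factorial + 1 / 2 ^ rejP n) with hpdef
  refine (one_sub_pow_le_exp_neg_mul hp₁ (rejR n)).trans ?_
  have hR : (rejR n : ℝ) = 96 * ((Nat.sqrt n : ℝ) + 1) * n := by unfold rejR; push_cast; ring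
  have hpR : (n : ℝ) ≤ p * rejR n := by
    rw [hR]
    have hsq1 : (0 : ℝ) < (Nat.sqrt n : ℝ) + 1 := by positivity
    calc (n : ℝ) = 1 / (96 * ((Nat.sqrt n : ℝ) + 1)) * (96 * ((Nat.sqrt n : ℝ) + 1) * n) := by field_simp
      _ ≤ p * (96 * ((Nat.sqrt n : ℝ) + 1) * n) := mul_le_mul_of_nonneg_right hp₀ (by positivity)
  exact (Real.exp_le_exp.2 (by linarith)).trans (exp_neg_le_inv_two_pow n)

/-- **Term 2**: `e·2^{w+1}·η/(m+1) ≤ 48A·2^{-n}`. [folklore] -/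
theorem rej_term2 (c n : ℕ) :
    Real.exp 1 * 2 ^ (rejW c n + 1) * ((2 : ℝ) ^ (rejS n + 1) / (rejN n).factorial + 1 / 2 ^ rejP n) / ((rejM c n : ℝ) + 1) ≤
      48 * (gridA c n : ℝ) / (2 : ℝ) ^ n := by
  have hw2' : ((2 : ℝ) ^ rejW c n) ≤ 4 * gridA c n := by exact_mod_cast (window_bounds c n).2
  have hηle := rejEta_le n
  have he1 : Real.exp 1 ≤ 3 := le_of_lt (lt_trans Real.exp_one_lt_d9 (by norm_num))
  have hη0 : (0 : ℝ) ≤ (2 : ℝ) ^ (rejS n + 1) / (rejN n).factorial + 1 / 2 ^ rejP n := by positivity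
  have hm1' : (1 : ℝ) ≤ (rejM c n : ℝ) + 1 := by
    have := Nat.cast_nonneg (α := ℝ) (rejM c n); linarith
  have hnum : Real.exp 1 * 2 ^ (rejW c n + 1) * ((2 : ℝ) ^ (rejS n + 1) / (rejN n).factorial + 1 / 2 ^ rejP n) ≤
      48 * (gridA c n : ℝ) / (2 : ℝ) ^ n := by
    have h1 : Real.exp 1 * 2 ^ (rejW c n + 1) ≤ 3 * (8 * gridA c n) := by
      rw [pow_succ]
      exact mul_le_mul he1 (by linarith) (by positivity) (by norm_num)
    calc Real.exp 1 * 2 ^ (rejW c n + 1) * ((2 : ℝ) ^ (rejS n + 1) / (rejN n).factorial + 1 / 2 ^ rejP n)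
        ≤ (3 * (8 * gridA c n)) * (2 / (2 : ℝ) ^ n) := mul_le_mul h1 hηle hη0 (by positivity)
      _ = 48 * (gridA c n : ℝ) / (2 : ℝ) ^ n := by ring
  calc Real.exp 1 * 2 ^ (rejW c n + 1) * ((2 : ℝ) ^ (rejS n + 1) / (rejN n).factorial + 1 / 2 ^ rejP n) / ((rejM c n : ℝ) + 1)
      ≤ Real.exp 1 * 2 ^ (rejW c n + 1) * ((2 : ℝ) ^ (rejS n + 1) / (rejN n).factorial + 1 / 2 ^ rejP n) / 1 :=
        div_le_div_of_nonneg_left (by positivity) one_pos hm1'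
    _ ≤ 48 * (gridA c n : ℝ) / (2 : ℝ) ^ n := by rw [div_one]; exact hnum

/-- **Term 3** (the tail beyond the window): `2e·e^{-θ(2ʷ-½)²}(1 + 1/(2θ(2ʷ-½))) ≤ 12·2^{-n}`
(`2ʷ - ½ ≥ 3A/2`, `θ(2ʷ-½)² ≥ 9n/4 ≥ n`, `2θ(2ʷ-½) ≥ 3n/A ≥ 1` when `A ≤ 3n`). [folklore] -/
theorem rej_term3 (c : ℕ) {n : ℕ} (hn : 0 < n) (hbig : (gridA c n : ℝ) ≤ 3 * n) :
    Real.exp 1 * (2 * Real.exp (-((gridTheta c n : ℝ) * ((2 : ℝ) ^ rejW c n - 1 / 2) ^ 2)) *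
      (1 + 1 / (2 * (gridTheta c n : ℝ) * ((2 : ℝ) ^ rejW c n - 1 / 2)))) ≤ 12 / (2 : ℝ) ^ n := by
  have hn' : (0 : ℝ) < n := by exact_mod_cast hn
  have hA : (0 : ℝ) < gridA c n := by exact_mod_cast gridA_pos c n
  have hA1 : (1 : ℝ) ≤ gridA c n := by exact_mod_cast gridA_pos c n
  have hw1' : 2 * (gridA c n : ℝ) < (2 : ℝ) ^ rejW c n := by exact_mod_cast (window_bounds c n).1
  have he1 : Real.exp 1 ≤ 3 := le_of_lt (lt_trans Real.exp_one_lt_d9 (by norm_num))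
  have hx : 3 / 2 * (gridA c n : ℝ) ≤ (2 : ℝ) ^ rejW c n - 1 / 2 := by linarith
  have hx0 : (0 : ℝ) < (2 : ℝ) ^ rejW c n - 1 / 2 := lt_of_lt_of_le (by positivity) hx
  have hθ : ((gridTheta c n : ℚ) : ℝ) = (n : ℝ) / (gridA c n : ℝ) ^ 2 := cast_gridTheta c n
  have hθ0 : (0 : ℝ) < (gridTheta c n : ℝ) := by rw [hθ]; positivity
  have hexp_arg : (n : ℝ) ≤ (gridTheta c n : ℝ) * ((2 : ℝ) ^ rejW c n - 1 / 2) ^ 2 := by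
    have h1 : (n : ℝ) ≤ (gridTheta c n : ℝ) * (3 / 2 * gridA c n) ^ 2 := by
      rw [hθ, div_mul_eq_mul_div, le_div_iff₀ (by positivity)]
      nlinarith
    exact h1.trans (mul_le_mul_of_nonneg_left (pow_le_pow_left₀ (by positivity) hx 2) hθ0.le)
  have hden : (1 : ℝ) ≤ 2 * (gridTheta c n : ℝ) * ((2 : ℝ) ^ rejW c n - 1 / 2) := by
    have h1 : (1 : ℝ) ≤ 2 * (gridTheta c n : ℝ) * (3 / 2 * gridA c n) := by
      rw [hθ]
      have e : 2 * ((n : ℝ) / (gridA c n : ℝ) ^ 2) * (3 / 2 * gridA c n) = 3 * n / gridA c n := by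
        field_simp
      rw [e, le_div_iff₀ hA]
      linarith
    exact h1.trans (mul_le_mul_of_nonneg_left hx (by positivity))
  have hfac : 1 + 1 / (2 * (gridTheta c n : ℝ) * ((2 : ℝ) ^ rejW c n - 1 / 2)) ≤ 2 := by
    have : 1 / (2 * (gridTheta c n : ℝ) * ((2 : ℝ) ^ rejW c n - 1 / 2)) ≤ 1 := by
      rw [div_le_one (by positivity)]; exact hden
    linarith
  have hexp : Real.exp (-((gridTheta c n : ℝ) * ((2 : ℝ) ^ rejW c n - 1 / 2) ^ 2)) ≤ 1 / (2 : ℝ) ^ n :=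
    (Real.exp_le_exp.2 (by linarith)).trans (exp_neg_le_inv_two_pow n)
  have hfac0 : 0 ≤ 1 + 1 / (2 * (gridTheta c n : ℝ) * ((2 : ℝ) ^ rejW c n - 1 / 2)) := by positivity
  calc Real.exp 1 * (2 * Real.exp (-((gridTheta c n : ℝ) * ((2 : ℝ) ^ rejW c n - 1 / 2) ^ 2)) *
        (1 + 1 / (2 * (gridTheta c n : ℝ) * ((2 : ℝ) ^ rejW c n - 1 / 2))))
      ≤ 3 * (2 * (1 / (2 : ℝ) ^ n) * 2) := by
        refine mul_le_mul he1 ?_ (by positivity) (by norm_num)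
        exact mul_le_mul (mul_le_mul_of_nonneg_left hexp (by norm_num)) hfac hfac0 (by positivity)
    _ = 12 / (2 : ℝ) ^ n := by ring

/-- **The rejection sampler at the grid parameters is `(13 + 48A)·2^{-n}`-close to `D_{ℤ,√(π/θ),c'}`** for `n ≥ 16`
(and `A ≤ 3n`), uniformly in the centre `c'`. [cite: GentryPeikertVaikuntanathan2008, Lemma 4.2; BrakerskiEtAl2013, §5] -/
theorem tvDist_rejLaw_grid_le (c : ℕ) {n : ℕ} (hn : 16 ≤ n) (hbig : (gridA c n : ℝ) ≤ 3 * n) (c' : ℚ) :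
    (GaussRej.rejLaw (gridTheta c n) c' (rejS n) (rejN n) (rejP n) (rejW c n) (rejR n)).tvDist
        (discreteGaussianInt (Real.sqrt (π / (gridTheta c n : ℝ))) c') ≤ (13 + 48 * (gridA c n : ℝ)) / (2 : ℝ) ^ n := by
  have hn0 : 0 < n := by omega
  have hbound := GaussRej.tvDist_rejLaw_le_of_params (gridTheta_pos hn0) (gridTheta_le_one c n) c' (rejP n) (rejW c n)
    (rejR n) (m := rejM c n) (s := rejS n) (N := rejN n) (by unfold rejN; omega) (rejS_spec c hn0) (rejM_spec c hn0)
    (rejM_lt_window c n) (rejEta_le_half (by omega))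
  refine hbound.trans ?_
  have h1 := rej_term1 c hn
  have h2 := rej_term2 c n
  have h3 := rej_term3 c hn0 hbig
  have h2n : (0 : ℝ) < (2 : ℝ) ^ n := by positivity
  have : 1 / (2 : ℝ) ^ n + 48 * (gridA c n : ℝ) / (2 : ℝ) ^ n + 12 / (2 : ℝ) ^ n = (13 + 48 * (gridA c n : ℝ)) / (2 : ℝ) ^ n := by
    field_simp; ring
  linarith

/-- **`A ≤ 3n` eventually** (`A² ≤ 12(c+1)·n ln n ≤ 24(c+1)·n√n ≤ 8n²` once `√n ≥ 3(c+1)`). [folklore] -/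
theorem eventually_gridA_le_three_mul (c : ℕ) : ∀ᶠ n : ℕ in atTop, (gridA c n : ℝ) ≤ 3 * n := by
  filter_upwards [eventually_ge_atTop ((3 * (c + 1)) ^ 2 + 4)] with n hnn
  have hn : 0 < n := by omega
  have h4 : (4 : ℝ) ≤ n := by exact_mod_cast (by omega : 4 ≤ n)
  have hn0 : (0 : ℝ) < n := by linarith
  have hsq : ((gridA c n : ℕ) : ℝ) ^ 2 ≤ 4 * ((n : ℝ) * (c + 1) * ((Nat.log 2 n : ℝ) + 2)) := by
    exact_mod_cast gridA_sq_le (c := c) (by omega : 1 ≤ n)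
  have hL : (Nat.log 2 n : ℝ) + 2 ≤ 3 * Real.log n := by
    have h := natLog_le_log n hn
    have hl4 : (1.38 : ℝ) ≤ Real.log n := by
      have := Real.log_le_log (by norm_num : (0 : ℝ) < 4) h4
      have h4' : (1.38 : ℝ) ≤ Real.log 4 := by
        rw [show (4 : ℝ) = 2 ^ 2 by norm_num, Real.log_pow]
        have := Real.log_two_gt_d9
        push_cast; linarith
      linarith
    linarith
  have hls : Real.log n ≤ 2 * Real.sqrt n := by
    have h := Real.log_le_sub_one_of_pos (Real.sqrt_pos.2 hn0)
    rw [Real.log_sqrt hn0.le] at h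
    linarith [Real.sqrt_nonneg (n : ℝ)]
  have hroot : (3 * ((c : ℝ) + 1)) ≤ Real.sqrt n := by
    rw [Real.le_sqrt (by positivity) hn0.le]
    exact_mod_cast (by omega : (3 * (c + 1)) ^ 2 ≤ n)
  have hsn : Real.sqrt n * Real.sqrt n = n := Real.mul_self_sqrt hn0.le
  -- `A² ≤ 12(c+1) n ln n ≤ 24(c+1) n √n ≤ 8 n √n √n = 8n² ≤ 9n²`
  have hA2 : ((gridA c n : ℕ) : ℝ) ^ 2 ≤ 9 * (n : ℝ) ^ 2 := by
    have hc0 : (0 : ℝ) ≤ c := Nat.cast_nonneg c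
    have h1 : ((gridA c n : ℕ) : ℝ) ^ 2 ≤ 12 * ((c : ℝ) + 1) * n * Real.log n := by
      calc ((gridA c n : ℕ) : ℝ) ^ 2 ≤ 4 * ((n : ℝ) * (c + 1) * ((Nat.log 2 n : ℝ) + 2)) := hsq
        _ ≤ 4 * ((n : ℝ) * (c + 1) * (3 * Real.log n)) := by gcongr
        _ = 12 * ((c : ℝ) + 1) * n * Real.log n := by ring
    have h2 : 12 * ((c : ℝ) + 1) * n * Real.log n ≤ 12 * ((c : ℝ) + 1) * n * (2 * Real.sqrt n) :=
      mul_le_mul_of_nonneg_left hls (by positivity)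
    have h3 : 12 * ((c : ℝ) + 1) * n * (2 * Real.sqrt n) = 8 * n * ((3 * ((c : ℝ) + 1)) * Real.sqrt n) := by ring
    have h4' : 8 * (n : ℝ) * ((3 * ((c : ℝ) + 1)) * Real.sqrt n) ≤ 8 * n * (Real.sqrt n * Real.sqrt n) :=
      mul_le_mul_of_nonneg_left (mul_le_mul_of_nonneg_right hroot (Real.sqrt_nonneg _)) (by positivity)
    rw [hsn] at h4'
    nlinarith
  have hA0 : (0 : ℝ) ≤ gridA c n := Nat.cast_nonneg _
  nlinarith

/-- **… hence negligible**: for every `k`, eventually `Δ ≤ 1/n^k` for all centres. [cite: BrakerskiEtAl2013, §5] -/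
theorem eventually_rejLaw_grid_le_pow (c k : ℕ) :
    ∀ᶠ n : ℕ in atTop, ∀ c' : ℚ,
      (GaussRej.rejLaw (gridTheta c n) c' (rejS n) (rejN n) (rejP n) (rejW c n) (rejR n)).tvDist
        (discreteGaussianInt (Real.sqrt (π / (gridTheta c n : ℝ))) c') ≤ 1 / (n : ℝ) ^ k := by
  -- `(13 + 144 n) n^k ≤ 2ⁿ` eventually
  have hpoly : ∀ᶠ n : ℕ in atTop, (13 + 48 * (3 * (n : ℝ))) * (n : ℝ) ^ k ≤ (2 : ℝ) ^ n := by
    have h := tendsto_pow_const_div_const_pow_of_one_lt (k + 1) (one_lt_two : (1 : ℝ) < 2)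
    have h2 : ∀ᶠ m : ℕ in atTop, (m : ℝ) ^ (k + 1) / 2 ^ m ≤ 1 / 200 :=
      h.eventually (ge_mem_nhds (by norm_num : (0 : ℝ) < 1 / 200))
    filter_upwards [h2, eventually_ge_atTop 1] with n hn h1
    have hn1 : (1 : ℝ) ≤ n := by exact_mod_cast h1
    rw [div_le_div_iff₀ (by positivity) (by norm_num), one_mul] at hn
    calc (13 + 48 * (3 * (n : ℝ))) * (n : ℝ) ^ k ≤ (200 * n) * (n : ℝ) ^ k := by
          apply mul_le_mul_of_nonneg_right _ (by positivity); linarith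
      _ = (n : ℝ) ^ (k + 1) * 200 := by ring
      _ ≤ (2 : ℝ) ^ n := hn
  have hAle := eventually_gridA_le_three_mul c
  filter_upwards [hpoly, hAle, eventually_ge_atTop 16] with n hpn hAn h16 c'
  have hn0 : (0 : ℝ) < n := by exact_mod_cast (by omega : 0 < n)
  refine (tvDist_rejLaw_grid_le c h16 hAn c').trans ?_
  rw [div_le_div_iff₀ (by positivity) (by positivity), one_mul]
  calc (13 + 48 * (gridA c n : ℝ)) * (n : ℝ) ^ k ≤ (13 + 48 * (3 * (n : ℝ))) * (n : ℝ) ^ k := by gcongr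
    _ ≤ (2 : ℝ) ^ n := hpn

end Bound

end BLPRS2013

end Literature.Computability.Cryptography

end
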